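import Mathlib
import Summits.Ventures.PercRepro2.CoinChainXAGR1Fact

/-!
# The `HG` fact: the `x`-unmarked surviving clusters are `y`-poorer than the `x`-marked ones
(blind cell PercRepro2, night-2 g32; proofs/NIGHT2-DARC.md §73.7g)

`cg_fact_HG`: `(U₂ + b₂)·(XU + XM) ≤ (a + u₀ + U₂ + b + b₂)·(XYU + XYM)` — the gate-killed law `νd·(1 − x)` with the
marker `y` against the gate `νd·x`: one four-functions instance over the whole lattice with `L₁ = νd·(1 − x)·y`,
`L₂ = νd·x`, `L₃ = R¹·(1 − x)`, `L₄ = νd·xy` (`R¹ = ν·(c on the ideal, d elsewhere)`; the meet of an `x`-unmarked and an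
`x`-marked cluster is `x`-unmarked, their join carries both markers; the law inequality is `gr1_law_pw`).
-/

namespace Summit.Ventures.PercRepro2.Coin

open Classical

section HGFact

variable {V : Type*} [DecidableEq V] {R : Type*} [Field R] [LinearOrder R] [IsStrictOrderedRing R]

/-- **The `HG` fact** `(U₂ + b₂)·(XU + XM) ≤ (a + u₀ + U₂ + b + b₂)·(XYU + XYM)`. -/
theorem cg_fact_HG (U : Finset V) (m : V) (ent' : Finset V) (ν c d : Finset V → R)
    (hν0 : ∀ W, 0 ≤ ν W) (hν : ∀ s ⊆ U, ∀ t ⊆ U, ν s * ν t ≤ ν (s ∩ t) * ν (s ∪ t))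
    (hc0 : ∀ W, 0 ≤ c W) (hd0 : ∀ W, 0 ≤ d W) (hdc : ∀ W, d W ≤ c W)
    (hcd : ∀ s t, c s * d t ≤ c (s ∩ t) * d (s ∪ t)) (hdd : ∀ s t, d s * d t ≤ d (s ∩ t) * d (s ∪ t))
    (x y : Finset V → R) (hx0 : ∀ W, 0 ≤ x W) (hy0 : ∀ W, 0 ≤ y W) (hx1 : ∀ W, x W ≤ 1)
    (hxm : ∀ s t, x s ≤ x (s ∪ t)) (hym : ∀ s t, y s ≤ y (s ∪ t))
    (hxI : ∀ W, (¬ ∃ r ∈ ({m} : Finset V) ∪ ent', r ∈ W) → x W = 0)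
    (hyI : ∀ W, (¬ ∃ r ∈ ({m} : Finset V) ∪ ent', r ∈ W) → y W = 0) :
    ((∑ W ∈ U.powerset.filter (fun W => (¬ ∃ r ∈ ({m} : Finset V), r ∈ W) ∧ ∃ r ∈ ent', r ∈ W), ν W * d W * ((1 - x W) * y W)) + (∑ W ∈ U.powerset.filter (fun W => ∃ r ∈ ({m} : Finset V), r ∈ W), ν W * d W * ((1 - x W) * y W)))
      * ((∑ W ∈ U.powerset.filter (fun W => (¬ ∃ r ∈ ({m} : Finset V), r ∈ W) ∧ ∃ r ∈ ent', r ∈ W), ν W * d W * x W) + (∑ W ∈ U.powerset.filter (fun W => ∃ r ∈ ({m} : Finset V), r ∈ W), ν W * d W * x W)) ≤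
    ((∑ W ∈ U.powerset.filter (fun W => ¬ ∃ r ∈ ({m} : Finset V) ∪ ent', r ∈ W), ν W * c W) + (∑ W ∈ U.powerset.filter (fun W => (¬ ∃ r ∈ ({m} : Finset V), r ∈ W) ∧ ∃ r ∈ ent', r ∈ W), ν W * d W * (1 - x W)) + (∑ W ∈ U.powerset.filter (fun W => ∃ r ∈ ({m} : Finset V), r ∈ W), ν W * d W * (1 - x W)))
      * ((∑ W ∈ U.powerset.filter (fun W => (¬ ∃ r ∈ ({m} : Finset V), r ∈ W) ∧ ∃ r ∈ ent', r ∈ W), ν W * d W * (x W * y W)) + (∑ W ∈ U.powerset.filter (fun W => ∃ r ∈ ({m} : Finset V), r ∈ W), ν W * d W * (x W * y W))) := by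
  set ρ : Finset V → R := fun W => if ∃ r ∈ ({m} : Finset V) ∪ ent', r ∈ W then d W else c W with hρ
  have hρ0 : ∀ W, 0 ≤ ρ W := fun W => by simp only [hρ]; split_ifs <;> [exact hd0 W; exact hc0 W]
  have hx1' : ∀ W, 0 ≤ 1 - x W := fun W => sub_nonneg.2 (hx1 W)
  have key := ad_sets_dec U (fun W => ν W * d W * ((1 - x W) * y W)) (fun W => ν W * d W * x W) (fun W => ν W * ρ W * (1 - x W))
    (fun W => ν W * d W * (x W * y W))
    (fun W => mul_nonneg (mul_nonneg (hν0 W) (hd0 W)) (mul_nonneg (hx1' W) (hy0 W))) (fun W => mul_nonneg (mul_nonneg (hν0 W) (hd0 W)) (hx0 W))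
    (fun W => mul_nonneg (mul_nonneg (hν0 W) (hρ0 W)) (hx1' W)) (fun W => mul_nonneg (mul_nonneg (hν0 W) (hd0 W)) (mul_nonneg (hx0 W) (hy0 W)))
    (fun _ => True) (fun _ => True) (fun _ => True) (fun _ => True) (by
      intro s hs t ht _ _
      refine ⟨trivial, trivial, ?_⟩
      have hxs : 1 - x (s ∩ t) ≥ 1 - x s := by
        have : x (s ∩ t) ≤ x s := by
          have h := hxm (s ∩ t) s; rwa [Finset.union_eq_right.2 Finset.inter_subset_left] at h
        linarith
      have hxt : x t ≤ x (s ∪ t) := by rw [Finset.union_comm]; exact hxm t s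
      have hys : y s ≤ y (s ∪ t) := hym s t
      have hlaw : d s * ρ t ≤ ρ (s ∩ t) * d (s ∪ t) := by
        simp only [hρ]; exact gr1_law_pw m ent' c d hd0 hdc hcd hdd s t
      have hw : (1 - x s) * y s * x t ≤ (1 - x (s ∩ t)) * (x (s ∪ t) * y (s ∪ t)) := by
        calc (1 - x s) * y s * x t = (1 - x s) * (x t * y s) := by ring
          _ ≤ (1 - x (s ∩ t)) * (x (s ∪ t) * y (s ∪ t)) :=
            mul_le_mul hxs (mul_le_mul hxt hys (hy0 s) (hx0 _)) (mul_nonneg (hx0 t) (hy0 s)) (hx1' _)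
      calc ν s * d s * ((1 - x s) * y s) * (ν t * d t * x t) = (ν s * ν t) * (d s * d t) * ((1 - x s) * y s * x t) := by ring
        _ ≤ (ν (s ∩ t) * ν (s ∪ t)) * (ρ (s ∩ t) * d (s ∪ t)) * ((1 - x (s ∩ t)) * (x (s ∪ t) * y (s ∪ t))) :=
            mul_le_mul (mul_le_mul (hν s hs t ht) (by
                calc d s * d t ≤ d (s ∩ t) * d (s ∪ t) := hdd s t
                  _ ≤ ρ (s ∩ t) * d (s ∪ t) := mul_le_mul_of_nonneg_right (by
                      simp only [hρ]; split_ifs <;> [exact le_rfl; exact hdc _]) (hd0 _))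
                (mul_nonneg (hd0 s) (hd0 t)) (mul_nonneg (hν0 _) (hν0 _)))
              hw (mul_nonneg (mul_nonneg (hx1' s) (hy0 s)) (hx0 t))
              (mul_nonneg (mul_nonneg (hν0 _) (hν0 _)) (mul_nonneg (hρ0 _) (hd0 _)))
        _ = ν (s ∩ t) * ρ (s ∩ t) * (1 - x (s ∩ t)) * (ν (s ∪ t) * d (s ∪ t) * (x (s ∪ t) * y (s ∪ t))) := by ring)
  simp only [Finset.filter_true] at key
  rw [sum_three_regions U {m} ent', sum_three_regions U {m} ent' (fun W => ν W * d W * x W),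
    sum_three_regions U {m} ent' (fun W => ν W * ρ W * (1 - x W)), sum_three_regions U {m} ent' (fun W => ν W * d W * (x W * y W))] at key
  have hI1 : (∑ W ∈ U.powerset.filter (fun W => ¬ ∃ r ∈ ({m} : Finset V) ∪ ent', r ∈ W), ν W * d W * ((1 - x W) * y W)) = 0 :=
    cgate_sum_zero U _ _ (fun W hW => by rw [hyI W hW, mul_zero, mul_zero])
  have hI2 : (∑ W ∈ U.powerset.filter (fun W => ¬ ∃ r ∈ ({m} : Finset V) ∪ ent', r ∈ W), ν W * d W * x W) = 0 :=
    cgate_sum_zero U _ _ (fun W hW => by rw [hxI W hW, mul_zero])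
  have hI4 : (∑ W ∈ U.powerset.filter (fun W => ¬ ∃ r ∈ ({m} : Finset V) ∪ ent', r ∈ W), ν W * d W * (x W * y W)) = 0 :=
    cgate_sum_zero U _ _ (fun W hW => by rw [hxI W hW, zero_mul, mul_zero])
  have hI3 : (∑ W ∈ U.powerset.filter (fun W => ¬ ∃ r ∈ ({m} : Finset V) ∪ ent', r ∈ W), ν W * ρ W * (1 - x W))
      = ∑ W ∈ U.powerset.filter (fun W => ¬ ∃ r ∈ ({m} : Finset V) ∪ ent', r ∈ W), ν W * c W :=
    Finset.sum_congr rfl (fun W hW => by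
      have h := (Finset.mem_filter.1 hW).2
      simp only [hρ, if_neg h, hxI W h]; ring)
  have hD : ∀ W : Finset V, ((¬ ∃ r ∈ ({m} : Finset V), r ∈ W) ∧ ∃ r ∈ ent', r ∈ W) → ∃ r ∈ ({m} : Finset V) ∪ ent', r ∈ W :=
    fun W h => by obtain ⟨r, hr, hrW⟩ := h.2; exact ⟨r, Finset.mem_union.2 (Or.inr hr), hrW⟩
  have hM : ∀ W : Finset V, (∃ r ∈ ({m} : Finset V), r ∈ W) → ∃ r ∈ ({m} : Finset V) ∪ ent', r ∈ W :=
    fun W h => by obtain ⟨r, hr, hrW⟩ := h; exact ⟨r, Finset.mem_union.2 (Or.inl hr), hrW⟩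
  have hD3 : (∑ W ∈ U.powerset.filter (fun W => (¬ ∃ r ∈ ({m} : Finset V), r ∈ W) ∧ ∃ r ∈ ent', r ∈ W), ν W * ρ W * (1 - x W))
      = ∑ W ∈ U.powerset.filter (fun W => (¬ ∃ r ∈ ({m} : Finset V), r ∈ W) ∧ ∃ r ∈ ent', r ∈ W), ν W * d W * (1 - x W) :=
    Finset.sum_congr rfl (fun W hW => by simp only [hρ, if_pos (hD W (Finset.mem_filter.1 hW).2)])
  have hM3 : (∑ W ∈ U.powerset.filter (fun W => ∃ r ∈ ({m} : Finset V), r ∈ W), ν W * ρ W * (1 - x W))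
      = ∑ W ∈ U.powerset.filter (fun W => ∃ r ∈ ({m} : Finset V), r ∈ W), ν W * d W * (1 - x W) :=
    Finset.sum_congr rfl (fun W hW => by simp only [hρ, if_pos (hM W (Finset.mem_filter.1 hW).2)])
  rw [hI1, hI2, hI3, hI4, hD3, hM3, zero_add, zero_add, zero_add] at key
  linear_combination key

end HGFact

end Summit.Ventures.PercRepro2.Coin
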